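import Summits.FinalStateConjecture.FinalStateConjecture.Theorems.PhotonSphereChannelsTameCensorshipLensCausality
import Literature.Geometry.Lorentzian.CauchyHypersurfaceGlobalHyperbolicity
import HarnessLib

/-!
# Crux `TameCensorship` (stmt-FinalStateConjecture-10047), line `crush-the-swallowed-interior`,
# fact-stub F1 `stub_factFutureCauchyCrushBound` — II: curves from `I⁻(S)`; `J⁺(S) ⊆ S ∪ I⁺(S)`

Continuation of `PhotonSphereChannelsTameCensorshipLensCausality` (same setting: `(M, g, τ)` Hausdorff, second countable,
finite-dimensional, boundaryless model, `Cⁿ` metric with `n ≥ 2`; `S ⊆ M` achronal; a **lens** is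
an open `V` in which `S ∩ V` is a Cauchy hypersurface of `(V, g|_V, τ|_V)`). We prove:

* `exists_mem_of_lens_of_mem_chronologicalPast` — **no future timelike curve from a point of
  `V ∩ I⁻(S)` avoids `S`**: if `z ∈ V ∩ I⁻(S)` and `δ` is a future timelike curve of `M` on an
  interval `s ∋ t₀`, `δ t₀ = z`, without future endpoint in `M`, then `δ t ∈ S` for some `t ≥ t₀`
  in `s` (the piece of `δ` inside `V` from `t₀` up to its first exit is a future timelike curve of
  `V` without future endpoint in `V`; `exists_mem_of_curve_in_lens`);
* `chronologicalFuture_inter_chronologicalPast_subset_lens` — for `x ∈ V ∩ I⁻(S)`,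
  **`I⁺(x) ∩ I⁻(S) ⊆ V`** (a timelike segment from `x` to a point of `I⁻(S)` cannot leave `V`: the
  piece before its first exit meets `S`, at `x` — excluded — or later, which would put the final
  point in `I⁺(S)`);
* `causalFuture_subset_of_lenses` — if `S` is closed and every point of `S` has a lens, then
  **`J⁺(S) ⊆ S ∪ I⁺(S)`** (after its last parameter on `S` a causal curve from `S` is in the lens of
  that point and off `S`, hence in `I⁺(S)` — then push-up — or in `I⁻(S)`, which would relate two
  points of `S` chronologically).

This is the causal half of O'Neill 1983, Ch. 14, Lemma 14.42 and Thm. 14.38 for an achronal set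
with local Cauchy lenses in place of an acausal topological hypersurface, proved without limit
curves. Everything is proved; no definitions, no named facts.

## References

* B. O'Neill, *Semi-Riemannian geometry with applications to relativity*, Academic Press 1983,
  Ch. 14, Cor. 14.1, Lemma 14.29, Thm. 14.38, Lemma 14.42 (pp. 402–425). [ONeillSemiRiemannian1983]
* S. W. Hawking, G. F. R. Ellis, *The large scale structure of space-time*, CUP 1973, §6.5–6.6,
  Prop. 6.6.3. [HawkingEllis1973CUP]
-/

noncomputable section

-- The tree namespace `Summit.FinalStateConjecture.FinalStateConjecture.…` (summit = sub-problem)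
-- repeats a component by design (D-0022), which the `dupNamespace` linter would flag on every decl.
set_option linter.dupNamespace false

open Bundle Set Filter Function Topology TopologicalSpace
open scoped Manifold ContDiff Topology

open Literature.Geometry.Lorentzian

namespace Summit.FinalStateConjecture.FinalStateConjecture.Theorems.PhotonSphereChannels.TameCensorshipCrush

variable {E : Type*} [NormedAddCommGroup E] [NormedSpace ℝ E] {H : Type*} [TopologicalSpace H]
  {I : ModelWithCorners ℝ E H} {n : ℕ∞ω} {M : Type*} [TopologicalSpace M] [ChartedSpace H M]
  [IsManifold I ∞ M] [T2Space M] [SecondCountableTopology M] [I.Boundaryless]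
  [FiniteDimensional ℝ E]

variable {g : LorentzianMetric I n M} {τ : TimeOrientation g}
  (hres : PseudoRiemannianMetric.contMDiff_restrict (I := I) (n := n) (M := M))
  (hτ : τ.contMDiff_restrict)

/-- **No future timelike curve from a point of `V ∩ I⁻(S)` avoids `S`.** Let `S` be achronal and
`S ∩ V` a Cauchy hypersurface of the open sub-spacetime `V`; let `z ∈ V ∩ I⁻(S)` and let `δ` be a
future timelike curve of `M` on an interval `s ∋ t₀` with `δ t₀ = z` and no future endpoint in `M`.
Then `δ t ∈ S` for some `t ≥ t₀` in `s`: the piece of `δ` from `t₀` up to its first exit from `V`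
(or all of it) is a future timelike curve of `V` without future endpoint in `V`, and
`exists_mem_of_curve_in_lens` applies. O'Neill 1983, Ch. 14, Thm. 14.38.
[cite: ONeillSemiRiemannian1983, Ch. 14, Thm. 14.38 (pp. 421–423)] -/
theorem exists_mem_of_lens_of_mem_chronologicalPast (hn : 2 ≤ n) {S : Set M}
    (hA : g.IsAchronal τ S) {V : Opens M}
    (hV : (g.restrict hres V).IsCauchyHypersurface (τ.restrict hres hτ V) (Subtype.val ⁻¹' S))
    {z : M} (hzV : z ∈ V) (hz : z ∈ g.chronologicalPast τ S) {δ : ℝ → M} {s : Set ℝ}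
    (hs : s.OrdConnected) (hδ : g.IsFutureTimelikeCurveOn τ δ s) (hend : IsFutureEndless δ s)
    {t₀ : ℝ} (ht₀ : t₀ ∈ s) (hδt₀ : δ t₀ = z) :
    ∃ t ∈ s, t₀ ≤ t ∧ δ t ∈ S := by
  obtain ⟨δ', hδ'⟩ := exists_lift_opens (O := (V : Set M)) hzV δ
  have hcontAt : ∀ t ∈ s, ContinuousAt δ t := fun t ht ↦ (hδ t ht).1.continuousAt
  -- the general step, for an initial piece `J` of `s ∩ [t₀, ∞)` inside `V`
  have key : ∀ J : Set ℝ, J ⊆ s → J.OrdConnected → t₀ ∈ J → J ⊆ Ici t₀ → (∀ t ∈ J, δ t ∈ V) →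
      IsFutureEndless δ' J → ∃ t ∈ s, t₀ ≤ t ∧ δ t ∈ S := by
    intro J hJs hJ ht₀J hJt₀ hJV hendJ
    have hagree : EqOn (Subtype.val ∘ δ') δ J := fun t ht ↦ hδ' t (hJV t ht)
    have hδ'c : (g.restrict hres V).IsFutureTimelikeCurveOn (τ.restrict hres hτ V) δ' J := by
      rw [LorentzianMetric.isFutureTimelikeCurveOn_restrict_iff g τ hres hτ V]
      exact (isFutureTimelikeCurveOn_congr_iff fun t ht ↦
        eventuallyEq_of_lift V.isOpen hδ' (hcontAt t (hJs ht)) (hJV t ht)).mpr (hδ.mono hJs)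
    have hz' : (δ' t₀ : M) ∈ g.chronologicalPast τ S := by
      rw [show (δ' t₀ : M) = δ t₀ from hagree ht₀J, hδt₀]
      exact hz
    obtain ⟨t, htJ, htS⟩ :=
      exists_mem_of_curve_in_lens hres hτ hn hA hV hJ ht₀J hJt₀ hδ'c hendJ hz'
    refine ⟨t, hJs htJ, hJt₀ htJ, ?_⟩
    rw [← show (δ' t : M) = δ t from hagree htJ]
    exact htS
  by_cases hin : ∀ t ∈ s, t₀ ≤ t → δ t ∈ V
  · -- the whole future part of `δ` lies in `V`
    refine key (s ∩ Ici t₀) inter_subset_left (hs.inter ordConnected_Ici) ⟨ht₀, self_mem_Ici⟩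
      inter_subset_right (fun t ht ↦ hin t ht.1 ht.2) ?_
    have hagree : EqOn (Subtype.val ∘ δ') δ (s ∩ Ici t₀) := fun t ht ↦ hδ' t (hin t ht.1 ht.2)
    have h1 : IsFutureEndless δ (s ∩ Ici t₀) := isFutureEndless_inter_Ici hend ht₀
    refine IsFutureEndless.of_subtypeVal_comp ⟨h1.1, fun p hp ↦ h1.2 p ?_⟩
    exact (hasFutureEndpoint_congr_eqOn hagree p).mp hp
  · -- `δ` leaves `V` after `t₀`: first exit at `te`
    push Not at hin
    obtain ⟨tb, htb, ht₀tb, htbV⟩ := hin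
    have hcont : ContinuousOn δ (Icc t₀ tb) := fun t ht ↦
      (hcontAt t (hs.out ht₀ htb ht)).continuousWithinAt
    obtain ⟨te, hte, hteV, hbefore⟩ :=
      exists_first_exit V.isOpen ht₀tb hcont (by rw [hδt₀]; exact hzV) htbV
    have htes : te ∈ s := hs.out ht₀ htb ⟨hte.1.le, hte.2⟩
    have hJs : Ico t₀ te ⊆ s := fun t ht ↦ hs.out ht₀ htes ⟨ht.1, ht.2.le⟩
    refine key (Ico t₀ te) hJs ordConnected_Ico ⟨le_rfl, hte.1⟩ (fun t ht ↦ ht.1) hbefore ?_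
    have hagree : EqOn (Subtype.val ∘ δ') δ (Ico t₀ te) := fun t ht ↦ hδ' t (hbefore t ht)
    refine ⟨⟨t₀, le_rfl, hte.1⟩, fun p hp ↦ ?_⟩
    have hpM : HasFutureEndpoint δ (Ico t₀ te) (p : M) :=
      (hasFutureEndpoint_congr_eqOn hagree _).mp (hasFutureEndpoint_subtypeVal_comp_iff.mpr hp)
    have hlim : HasFutureEndpoint δ (Ico t₀ te) (δ te) := by
      rw [hasFutureEndpoint_Ico_iff hte.1]
      exact ((hcontAt te htes).continuousWithinAt (s := Iio te)).tendsto
    haveI : Nonempty (Ico t₀ te) := ⟨⟨t₀, le_rfl, hte.1⟩⟩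
    have heq : (p : M) = δ te := tendsto_nhds_unique hpM hlim
    exact hteV (heq ▸ p.2)

/-- **A timelike segment from a point of `V ∩ I⁻(S)` to a point of `I⁻(S)` stays in `V`**: for
`S` achronal, `S ∩ V` a Cauchy hypersurface of `V` and `x ∈ V ∩ I⁻(S)`, one has
`I⁺(x) ∩ I⁻(S) ⊆ V`. A segment from `x` to `z ∈ I⁻(S)` leaving `V` would do so at a first parameter;
the piece before, a timelike curve of `V` without future endpoint in `V`, meets `S`
(`exists_mem_of_curve_in_lens`): at `x` this contradicts `x ∉ S`, later it gives `z ∈ I⁺(S)`.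
O'Neill 1983, Ch. 14, Thm. 14.38. [cite: ONeillSemiRiemannian1983, Ch. 14, Thm. 14.38 (pp. 421–423)] -/
theorem chronologicalFuture_inter_chronologicalPast_subset_lens (hn : 2 ≤ n) {S : Set M}
    (hA : g.IsAchronal τ S) {V : Opens M}
    (hV : (g.restrict hres V).IsCauchyHypersurface (τ.restrict hres hτ V) (Subtype.val ⁻¹' S))
    {x : M} (hxV : x ∈ V) (hx : x ∈ g.chronologicalPast τ S) :
    g.chronologicalFuture τ {x} ∩ g.chronologicalPast τ S ⊆ (V : Set M) := by
  rintro z ⟨⟨x₀, hx₀, σ, a, b, hab, hσ, hσa, hσb⟩, hzS⟩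
  rw [mem_singleton_iff] at hx₀
  subst hx₀
  have hdisj : Disjoint (g.chronologicalFuture τ S) (g.chronologicalPast τ S) :=
    hA.disjoint_chronologicalFuture_chronologicalPast
  by_contra hzV
  have hcontAt : ∀ t ∈ Icc a b, ContinuousAt σ t := fun t ht ↦ (hσ t ht).1.continuousAt
  have hcont : ContinuousOn σ (Icc a b) := fun t ht ↦ (hcontAt t ht).continuousWithinAt
  obtain ⟨te, hte, hteV, hbefore⟩ :=
    exists_first_exit V.isOpen hab.le hcont (by rw [hσa]; exact hxV) (by rw [hσb]; exact hzV)
  obtain ⟨σ', hσ'⟩ := exists_lift_opens (O := (V : Set M)) hxV σ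
  have hagree : EqOn (Subtype.val ∘ σ') σ (Ico a te) := fun t ht ↦ hσ' t (hbefore t ht)
  have hJs : Ico a te ⊆ Icc a b := fun t ht ↦ ⟨ht.1, ht.2.le.trans hte.2⟩
  have hσ'c : (g.restrict hres V).IsFutureTimelikeCurveOn (τ.restrict hres hτ V) σ' (Ico a te) := by
    rw [LorentzianMetric.isFutureTimelikeCurveOn_restrict_iff g τ hres hτ V]
    exact (isFutureTimelikeCurveOn_congr_iff fun t ht ↦
      eventuallyEq_of_lift V.isOpen hσ' (hcontAt t (hJs ht)) (hbefore t ht)).mpr (hσ.mono hJs)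
  have hendJ : IsFutureEndless σ' (Ico a te) := by
    refine ⟨⟨a, le_rfl, hte.1⟩, fun p hp ↦ ?_⟩
    have hpM : HasFutureEndpoint σ (Ico a te) (p : M) :=
      (hasFutureEndpoint_congr_eqOn hagree _).mp (hasFutureEndpoint_subtypeVal_comp_iff.mpr hp)
    have hlim : HasFutureEndpoint σ (Ico a te) (σ te) := by
      rw [hasFutureEndpoint_Ico_iff hte.1]
      exact ((hcontAt te ⟨hte.1.le, hte.2⟩).continuousWithinAt (s := Iio te)).tendsto
    haveI : Nonempty (Ico a te) := ⟨⟨a, le_rfl, hte.1⟩⟩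
    have heq : (p : M) = σ te := tendsto_nhds_unique hpM hlim
    exact hteV (heq ▸ p.2)
  have hx' : (σ' a : M) ∈ g.chronologicalPast τ S := by
    rw [show (σ' a : M) = σ a from hagree ⟨le_rfl, hte.1⟩, hσa]
    exact hx
  obtain ⟨t, htJ, htS⟩ := exists_mem_of_curve_in_lens hres hτ hn hA hV ordConnected_Ico
    ⟨le_rfl, hte.1⟩ (fun t ht ↦ ht.1) hσ'c hendJ hx'
  have htS' : σ t ∈ S := by
    rw [← show (σ' t : M) = σ t from hagree htJ]
    exact htS
  rcases eq_or_lt_of_le htJ.1 with h | h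
  · -- the crossing is `x` itself
    subst h
    rw [hσa] at htS'
    exact not_mem_of_isAchronal_of_mem_chronologicalPast hA hx htS'
  · -- the crossing is strictly between `x` and `z`: then `z ∈ I⁺(S)`
    have htb : t < b := lt_of_lt_of_le htJ.2 hte.2
    have hzF : z ∈ g.chronologicalFuture τ S :=
      ⟨σ t, htS', σ, t, b, htb, hσ.mono (Icc_subset_Icc h.le le_rfl), rfl, hσb⟩
    exact Set.disjoint_left.mp hdisj hzF hzS

/-- **`J⁺(S) ⊆ S ∪ I⁺(S)` for a closed achronal set with lenses at all its points.** Let `S` be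
closed and achronal, and suppose every point of `S` lies in an open `V` in which `S ∩ V` is a
Cauchy hypersurface. A causal curve from `S` to `q ∉ S` has a last parameter on `S` (closedness);
just after it the curve is in the lens of that point, off `S`, hence in `I⁺(S)` or `I⁻(S)`
(`mem_union_of_lens`); the latter would make two points of `S` chronologically related (push-up),
the former gives `q ∈ I⁺(S)` (push-up). O'Neill 1983, Ch. 14, Lemma 14.42 / Cor. 14.1.
[cite: ONeillSemiRiemannian1983, Ch. 14, Lemma 14.42 and Cor. 14.1 (pp. 402, 425)] -/
theorem causalFuture_subset_of_lenses (hn : 2 ≤ n) {S : Set M} (hSc : IsClosed S)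
    (hA : g.IsAchronal τ S)
    (hL : ∀ p ∈ S, ∃ V : Opens M, p ∈ V ∧
      (g.restrict hres V).IsCauchyHypersurface (τ.restrict hres hτ V) (Subtype.val ⁻¹' S)) :
    g.causalFuture τ S ⊆ S ∪ g.chronologicalFuture τ S := by
  have hn1 : (1 : ℕ∞ω) ≤ n := le_trans one_le_two hn
  intro q hq
  by_cases hqS : q ∈ S
  · exact Or.inl hqS
  right
  rcases hq with hq | ⟨p, hp, γ, a, b, hab, hγ, hγa, hγb⟩
  · exact absurd hq hqS
  have hcontAt : ∀ t ∈ Icc a b, ContinuousAt γ t := fun t ht ↦ (hγ t ht).1.continuousAt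
  have hcont : ContinuousOn γ (Icc a b) := fun t ht ↦ (hcontAt t ht).continuousWithinAt
  -- the last parameter on `S`
  set T : Set ℝ := Icc a b ∩ γ ⁻¹' S with hT
  have hTc : IsClosed T := hcont.preimage_isClosed_of_isClosed isClosed_Icc hSc
  have haT : a ∈ T := ⟨left_mem_Icc.mpr hab.le, by rw [mem_preimage, hγa]; exact hp⟩
  have hTbdd : BddAbove T := ⟨b, fun t ht ↦ ht.1.2⟩
  set ts := sSup T with hts_def
  have htsT : ts ∈ T := hTc.csSup_mem ⟨a, haT⟩ hTbdd
  have htsb : ts < b := by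
    refine lt_of_le_of_ne htsT.1.2 fun h ↦ hqS ?_
    rw [← hγb, ← h]
    exact htsT.2
  have hafter : ∀ t ∈ Ioc ts b, γ t ∉ S := fun t ht htS ↦
    (not_le.mpr ht.1) (le_csSup hTbdd ⟨⟨htsT.1.1.trans ht.1.le, ht.2⟩, htS⟩)
  obtain ⟨V, hpV, hV⟩ := hL (γ ts) htsT.2
  -- a parameter `t₁` just after `ts` with `γ t₁ ∈ V`, `t₁ < b`
  have hev : ∀ᶠ t in 𝓝[>] ts, γ t ∈ (V : Set M) ∧ t ∈ Ioo ts b := by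
    refine Filter.Eventually.and ?_ (Ioo_mem_nhdsGT htsb)
    exact nhdsWithin_le_nhds ((hcontAt ts htsT.1).preimage_mem_nhds (V.isOpen.mem_nhds hpV))
  obtain ⟨t₁, ht₁V, ht₁⟩ := hev.exists
  have hseg₁ : g.IsFutureCausalCurveOn τ γ (Icc ts t₁) :=
    hγ.mono (Icc_subset_Icc htsT.1.1 ht₁.2.le)
  have hseg₂ : g.IsFutureCausalCurveOn τ γ (Icc t₁ b) :=
    hγ.mono (Icc_subset_Icc (htsT.1.1.trans ht₁.1.le) le_rfl)
  rcases mem_union_of_lens hres hτ hn hV ht₁V with h | h | h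
  · exact absurd h (hafter t₁ ⟨ht₁.1, ht₁.2.le⟩)
  · -- `γ t₁ ∈ I⁺(S)` and `q ∈ J⁺(γ t₁)`
    have hqJ : q ∈ g.causalFuture τ {γ t₁} :=
      Or.inr ⟨γ t₁, rfl, γ, t₁, b, ht₁.2, hseg₂, rfl, hγb⟩
    exact LorentzianMetric.mem_chronologicalFuture_of_mem_chronologicalFuture_of_mem_causalFuture_set hn1 h hqJ
  · -- `γ t₁ ∈ I⁻(S)`: then `γ ts ≪ s₀` for some `s₀ ∈ S`, against achronality
    exfalso
    obtain ⟨s₀, hs₀, μ, c, d, hcd, hμ, hμc, hμd⟩ := h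
    have h1 : γ t₁ ∈ g.chronologicalPast τ {s₀} := ⟨s₀, rfl, μ, c, d, hcd, hμ, hμc, hμd⟩
    have h2 : s₀ ∈ g.chronologicalFuture τ {γ t₁} := LorentzianMetric.mem_chronologicalFuture_of_mem_chronologicalPast h1
    have h3 : γ t₁ ∈ g.causalFuture τ {γ ts} :=
      Or.inr ⟨γ ts, rfl, γ, ts, t₁, ht₁.1, hseg₁, rfl, rfl⟩
    exact hA (γ ts) htsT.2 s₀ hs₀ (LorentzianMetric.mem_chronologicalFuture_of_mem_causalFuture hn1 h3 h2)

end Summit.FinalStateConjecture.FinalStateConjecture.Theorems.PhotonSphereChannels.TameCensorshipCrush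

end
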